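import Summits.Parity.BatemanHorn.Theorems.SoloInformedMoebiusLogMomentLimit
import Summits.Parity.BatemanHorn.Theorems.SoloInformedMoebiusLogPowSplit
import Summits.Parity.BatemanHorn.Theorems.SoloInformedPsiKMoebiusForm
import Summits.Parity.BatemanHorn.Theorems.SoloInformedBatemanHornPsiKForm

/-!
# SoloInformedBatemanHornLocalisation — the Bateman–Horn conjecture is the large-divisor tail estimate

Solo unit `solo-Parity-informed` (ideation tier, informed mode), session 17; `PLAN.md` §25, CLAIMS C88.

**Theorem (unconditional, every system).**  Let `f : ι → ℤ[X]` be a Bateman–Horn system of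
`k ≥ 1` polynomials, `F = ∏ fᵢ`, and let `y(x) → ∞` with `y log^{2k-1} y = o(x)` (e.g.
`y = ⌊x^{1-ε}⌋`).  Then

  `BatemanHornAsymptotic f  ⟺  T_k(x; y) := ∑_{n ≤ x} ∑_{e ∣ F(n), e > y(x)} μ(e) logᵏ e = o(x)`.

More precisely (`psiK_sub_main_sub_tail_isLittleO`, unconditional):
`ψ_{k,f}(x) = k!·C(f)·x + (-1)ᵏ T_k(x; y) + o(x)`.
Consequently (`batemanHornConjecture_iff_forall_tail_isLittleO`) the conjunct `BatemanHorn` of the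
summit is *equivalent* to: for every Bateman–Horn system, the contribution of the divisors
`e > x^{1-ε}` of `F(n)` to `∑_{n ≤ x} (μ ⋆ logᵏ)(F(n))` is `o(x)`.

Ingredients (all kernel-checked in this programme): `ψ_k(x) ~ k! C(f) x ⟺ BH(f)`
(`SoloInformedSystemPsiK`); `ψ_k = (-1)ᵏ ∑ (μ ⋆ logᵏ)(F(n)) + o(x)` (`SoloInformedPsiKMoebiusForm`);
the divisor split with main term `x · M_k(y)` (`SoloInformedMoebiusLogPowSplit`); and the
unconditional limit `M_k(y) → (-1)ᵏ k! C(f)` (`SoloInformedMoebiusLogMomentLimit`, resting on the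
log-power decay of `∑ μ(n) ω_f(n)/n` for every system, `SoloInformedSystemMoebiusDecay`).
The small divisors carry exactly the Hardy–Littlewood–Bateman–Horn main term; all the difficulty
of the conjecture is the equidistribution of the Möbius sign over the large divisors of `F(n)` —
the parity barrier made into an equivalence.
-/

namespace Summit.Parity.BatemanHorn.Theorems

open Finset Filter ArithmeticFunction Asymptotics Polynomial
open scoped Topology Nat ArithmeticFunction.Moebius
open Literature.NumberTheory.Sieve (polyRootCountMod IsBatemanHornSystem batemanHornConst
  BatemanHornAsymptotic BatemanHornConjecture generalizedVonMangoldt)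
open Literature.NumberTheory.LFunctions (polyRootCountMod_prod_single)

variable {ι : Type*} [Fintype ι]

/-- **Unconditional asymptotic formula for `ψ_k` with the large-divisor tail as the only
unevaluated term.**  For a Bateman–Horn system `f` of `k ≥ 1` polynomials, `F = ∏ fᵢ`, and any
cut `y(x) → ∞` with `y log^{2k-1} y = o(x)`:
`ψ_{k,f}(x) = k!·C(f)·x + (-1)ᵏ ∑_{n ≤ x} ∑_{e ∣ F(n), e > y(x)} μ(e) logᵏ e + o(x)`,
where `ψ_{k,f}(x) = ∑_{n ≤ x} Λ_k(|F(n)|)`.  The small divisors `e ≤ y(x)` contribute exactly the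
Hardy–Littlewood–Bateman–Horn main term. -/
theorem psiK_sub_main_sub_tail_isLittleO {f : ι → ℤ[X]} (hf : IsBatemanHornSystem f)
    (hk : 0 < Fintype.card ι) {y : ℕ → ℕ} (hy : Tendsto y atTop atTop)
    (hy' : (fun x : ℕ => (y x : ℝ) * Real.log (y x) ^ (Fintype.card ι - 1 + Fintype.card ι))
      =o[atTop] fun x : ℕ => (x : ℝ)) :
    (fun x : ℕ =>
      (∑ n ∈ Icc 1 x, generalizedVonMangoldt (Fintype.card ι) ((∏ i, f i).eval (n : ℤ)).natAbs
        - ((Fintype.card ι)! : ℝ) * batemanHornConst f * (x : ℝ))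
      - (-1 : ℝ) ^ Fintype.card ι * ∑ n ∈ Icc 1 x,
          ∑ e ∈ (((∏ i, f i).eval (n : ℤ)).natAbs).divisors with y x < e,
            (μ e : ℝ) * Real.log e ^ Fintype.card ι) =o[atTop] fun x : ℕ => (x : ℝ) := by
  have hF : (∏ i, f i) ≠ 0 := prod_ne_zero_iff.mpr fun i _ => (hf.irreducible i).ne_zero
  -- (F2) `ψ_k - (-1)^k S = o(x)`
  have h2 := isLittleO_psiK_sub_moebiusLogPowSum hf hk
  -- (F3b) `S - A x - T = o(x)` with `A = (-1)^k k! C(f)`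
  obtain ⟨C₁, -, hC₁⟩ := exists_sum_abs_moebius_mul_sysRootCount_le' hf hk
  have hC₁' : ∀ t : ℝ, 2 ≤ t → ∑ m ∈ Icc 1 ⌊t⌋₊,
      |(μ m : ℝ)| * (polyRootCountMod ![∏ i, f i] m : ℝ) ≤
        C₁ * t * Real.log t ^ (Fintype.card ι - 1) := by
    intro t ht
    simp_rw [polyRootCountMod_prod_single]
    exact hC₁ t ht
  have hA : Tendsto (fun N : ℕ => ∑ e ∈ Icc 1 N, (μ e : ℝ) * Real.log e ^ Fintype.card ι *
      (polyRootCountMod ![∏ i, f i] e : ℝ) / e) atTop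
      (𝓝 ((-1) ^ Fintype.card ι * (Fintype.card ι)! * batemanHornConst f)) := by
    refine (tendsto_moebiusSysRootCount_logMoment hf hk).congr fun N => ?_
    refine sum_congr rfl fun e _ => ?_
    rw [polyRootCountMod_prod_single]
    ring
  have h3 := sum_sum_divisors_moebiusLogPow_sub_isLittleO hF hC₁' hA hy hy'
  -- combine: `(ψ_k - k! C x) - (-1)^k T = o(x)`
  have hsq : (-1 : ℝ) ^ Fintype.card ι * (-1) ^ Fintype.card ι = 1 := by
    rw [← mul_pow]; norm_num
  refine (h2.add (h3.const_mul_left ((-1 : ℝ) ^ Fintype.card ι))).congr_left fun x => ?_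
  linear_combination (-(((Fintype.card ι)! : ℝ) * batemanHornConst f * (x : ℝ))) * hsq

/-- **Localisation of the Bateman–Horn conjecture on the large divisors.**  For a Bateman–Horn
system `f` of `k ≥ 1` polynomials and any cut `y(x) → ∞` with `y log^{2k-1} y = o(x)`:
`BatemanHornAsymptotic f ↔ ∑_{n ≤ x} ∑_{e ∣ F(n), e > y(x)} μ(e) logᵏ e = o(x)`. -/
theorem batemanHornAsymptotic_iff_tail_isLittleO [Nonempty ι] {f : ι → ℤ[X]}
    (hf : IsBatemanHornSystem f) {y : ℕ → ℕ} (hy : Tendsto y atTop atTop)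
    (hy' : (fun x : ℕ => (y x : ℝ) * Real.log (y x) ^ (Fintype.card ι - 1 + Fintype.card ι))
      =o[atTop] fun x : ℕ => (x : ℝ)) :
    BatemanHornAsymptotic f ↔
      (fun x : ℕ => ∑ n ∈ Icc 1 x,
          ∑ e ∈ (((∏ i, f i).eval (n : ℤ)).natAbs).divisors with y x < e,
            (μ e : ℝ) * Real.log e ^ Fintype.card ι) =o[atTop] fun x : ℕ => (x : ℝ) := by
  have hk : 0 < Fintype.card ι := Fintype.card_pos
  obtain ⟨-, hCpos⟩ := IsBatemanHornSystem.hasBatemanHornConst_holds hf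
  have hE := psiK_sub_main_sub_tail_isLittleO hf hk hy hy'
  have hc : ((-1 : ℝ) ^ Fintype.card ι) ≠ 0 := pow_ne_zero _ (by norm_num)
  have hc' : ((Fintype.card ι)! : ℝ) * batemanHornConst f ≠ 0 :=
    mul_ne_zero (by positivity) hCpos.ne'
  rw [batemanHornAsymptotic_iff_isEquivalent_psiK hf]
  constructor
  · intro hψ
    have h1 := (isLittleO_const_mul_right_iff hc').mp hψ.isLittleO
    exact (isLittleO_const_mul_left_iff hc).mp (hE.congr_of_sub.mp h1)
  · intro hT
    have h1 := hE.congr_of_sub.mpr ((isLittleO_const_mul_left_iff hc).mpr hT)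
    exact (isLittleO_const_mul_right_iff hc').mpr h1

/-- **Centred form.**  Since `M_k(y) := ∑_{e ≤ y} μ(e) ω_f(e) logᵏ e / e → (-1)ᵏ k! C(f)` unconditionally
(`tendsto_moebiusSysRootCount_logMoment`), the tail may be centred at its expected value:
`BatemanHornAsymptotic f ↔ T_k(x; y) + x·(M_k(y(x)) - (-1)ᵏ k! C(f)) = o(x)`, i.e. the large divisors
`e > y(x)` of `F(n)` contribute exactly their expected share `x·((-1)ᵏ k! C(f) - M_k(y))`.  (Numerically
the two pieces `T_k` and `x (M_k(y) - (-1)ᵏ k! C(f))` are individually large and cancel: the singular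
series partial sums `M_k(y)` converge only at the de la Vallée-Poussin rate.) -/
theorem batemanHornAsymptotic_iff_centredTail_isLittleO [Nonempty ι] {f : ι → ℤ[X]}
    (hf : IsBatemanHornSystem f) {y : ℕ → ℕ} (hy : Tendsto y atTop atTop)
    (hy' : (fun x : ℕ => (y x : ℝ) * Real.log (y x) ^ (Fintype.card ι - 1 + Fintype.card ι))
      =o[atTop] fun x : ℕ => (x : ℝ)) :
    BatemanHornAsymptotic f ↔
      (fun x : ℕ => ∑ n ∈ Icc 1 x,
          ∑ e ∈ (((∏ i, f i).eval (n : ℤ)).natAbs).divisors with y x < e,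
            (μ e : ℝ) * Real.log e ^ Fintype.card ι
        + (x : ℝ) * (∑ e ∈ Icc 1 (y x), (μ e : ℝ) * (polyRootCountMod f e : ℝ) / e *
            Real.log e ^ Fintype.card ι
          - (-1) ^ Fintype.card ι * (Fintype.card ι)! * batemanHornConst f))
        =o[atTop] fun x : ℕ => (x : ℝ) := by
  have hk : 0 < Fintype.card ι := Fintype.card_pos
  set A : ℝ := (-1) ^ Fintype.card ι * (Fintype.card ι)! * batemanHornConst f with hA
  have hM : Tendsto (fun x : ℕ => ∑ e ∈ Icc 1 (y x), (μ e : ℝ) * (polyRootCountMod f e : ℝ) / e *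
      Real.log e ^ Fintype.card ι - A) atTop (𝓝 0) := by
    have h := ((tendsto_moebiusSysRootCount_logMoment hf hk).comp hy).sub_const A
    rw [sub_self] at h
    exact h
  have ho : (fun x : ℕ => (x : ℝ) * (∑ e ∈ Icc 1 (y x), (μ e : ℝ) * (polyRootCountMod f e : ℝ) / e *
      Real.log e ^ Fintype.card ι - A)) =o[atTop] fun x : ℕ => (x : ℝ) := by
    have h1 : (fun x : ℕ => ∑ e ∈ Icc 1 (y x), (μ e : ℝ) * (polyRootCountMod f e : ℝ) / e *
        Real.log e ^ Fintype.card ι - A) =o[atTop] fun _ : ℕ => (1 : ℝ) :=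
      (isLittleO_one_iff ℝ).mpr hM
    have h2 := (isBigO_refl (fun x : ℕ => (x : ℝ)) atTop).mul_isLittleO h1
    simpa only [mul_one] using h2
  rw [batemanHornAsymptotic_iff_tail_isLittleO hf hy hy']
  constructor
  · intro hT
    exact hT.add ho
  · intro h
    have h3 := h.sub ho
    refine h3.congr_left fun x => ?_
    simp only [hA, add_sub_cancel_right]

/-- The standard cut: for `0 < ε < 1`,
`BatemanHornAsymptotic f ↔ ∑_{n ≤ x} ∑_{e ∣ F(n), e > x^{1-ε}} μ(e) logᵏ e = o(x)`. -/
theorem batemanHornAsymptotic_iff_rpowCut_tail_isLittleO [Nonempty ι] {f : ι → ℤ[X]}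
    (hf : IsBatemanHornSystem f) {ε : ℝ} (hε : 0 < ε) (hε1 : ε < 1) :
    BatemanHornAsymptotic f ↔
      (fun x : ℕ => ∑ n ∈ Icc 1 x,
          ∑ e ∈ (((∏ i, f i).eval (n : ℤ)).natAbs).divisors with ⌊(x : ℝ) ^ (1 - ε)⌋₊ < e,
            (μ e : ℝ) * Real.log e ^ Fintype.card ι) =o[atTop] fun x : ℕ => (x : ℝ) :=
  batemanHornAsymptotic_iff_tail_isLittleO hf (tendsto_rpowCut_atTop hε1)
    (rpowCut_mul_log_pow_isLittleO hε hε1 _)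

/-- **The conjunct `BatemanHorn` of the summit, localised.**  For any fixed `0 < ε < 1`:
the Bateman–Horn conjecture holds iff for every Bateman–Horn system `f : Fin (k+1) → ℤ[X]`,
`∑_{n ≤ x} ∑_{e ∣ ∏ fᵢ(n), e > x^{1-ε}} μ(e) log^{k+1} e = o(x)`. -/
theorem batemanHornConjecture_iff_forall_tail_isLittleO {ε : ℝ} (hε : 0 < ε) (hε1 : ε < 1) :
    BatemanHornConjecture ↔ ∀ (k : ℕ) (f : Fin (k + 1) → ℤ[X]), IsBatemanHornSystem f →
      (fun x : ℕ => ∑ n ∈ Icc 1 x,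
          ∑ e ∈ (((∏ i, f i).eval (n : ℤ)).natAbs).divisors with ⌊(x : ℝ) ^ (1 - ε)⌋₊ < e,
            (μ e : ℝ) * Real.log e ^ (k + 1)) =o[atTop] fun x : ℕ => (x : ℝ) := by
  constructor
  · intro h k f hf
    have h' := (batemanHornAsymptotic_iff_rpowCut_tail_isLittleO hf hε hε1).mp (h (k + 1) f hf)
    simpa only [Fintype.card_fin] using h'
  · intro h k f hf
    cases k with
    | zero => exact batemanHornAsymptotic_of_isEmpty f
    | succ k =>
      have h' := h k f hf
      rw [batemanHornAsymptotic_iff_rpowCut_tail_isLittleO hf hε hε1]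
      simpa only [Fintype.card_fin] using h'

end Summit.Parity.BatemanHorn.Theorems
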